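import Mathlib.RingTheory.SimpleModule.Isotypic
import Mathlib.LinearAlgebra.Pi
import Mathlib.LinearAlgebra.Dimension.Constructions
import Mathlib.LinearAlgebra.Basis.VectorSpace

/-!
# The isotypic component of a finite direct sum `H^m` is the direct sum of the components

Kernel witness (cell pub-hodge-repro2, seat p5, Tier 5) for the dimension bound of
route/T5-N4-p5.md v12 (A3) STEP 5 (l. 147):

> «π₀^{K_f}[τ] ⊂ (m_{K_f}(π_∞) H_{π_∞})[τ] and dim π₀^{K_f}[τ] ≤ m_{K_f}(π_∞) · dim (H_{π_∞})_τ»,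

in its algebraic form: for an `R`-module `H`, a finite index type `ι` (`|ι| = m`) and a simple
`R`-module `S` (the type `τ`), the `S`-isotypic component of `ι → H = H^{⊕ m}` is the product of
the `S`-isotypic components of the factors (`isotypicComponent_pi`), hence is `R`-linearly
isomorphic to `ι → isotypicComponent R H S` (`isotypicComponentPiEquiv`), and — for `R` a
`k`-algebra and `H` finite-dimensional over `k` — has `k`-dimension `|ι| · dim_k (H[S])`
(`finrank_isotypicComponent_pi`).  With `R = k[K_∞]`, `H = H_{π_∞}`, `S = τ` this is STEP 5's
«(m H)[τ] has dimension m · dim H_τ»; the inclusion `π₀^{K_f}[τ] ⊂ (m H)[τ]` and the finiteness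
of `m` ([BW] VII 3.1) stay prose in (A3).  Mathlib only.
-/

namespace Summit.Ventures.HodgeRepro2.T5IsotypicPi

section Module

variable {R : Type*} [Ring R] {ι : Type*} [Fintype ι] [DecidableEq ι]
  {H : Type*} [AddCommGroup H] [Module R H] (S : Type*) [AddCommGroup S] [Module R S]

omit [Fintype ι] [DecidableEq ι] in
/-- A copy of a simple module inside `ι → H` projects into the isotypic component of each
factor. -/
theorem mem_isotypicComponent_apply [IsSimpleModule R S] {x : ι → H}
    (hx : x ∈ isotypicComponent R (ι → H) S) (i : ι) : x i ∈ isotypicComponent R H S := by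
  rw [isotypicComponent, sSup_eq_iSup'] at hx
  refine Submodule.iSup_induction (motive := fun y : ι → H => y i ∈ isotypicComponent R H S) _ hx
    ?_ (Submodule.zero_mem _) ?_
  · rintro ⟨m, ⟨e⟩⟩ y hy
    haveI : IsSimpleModule R m := IsSimpleModule.congr e
    have h := Submodule.map_le_isotypicComponent m (LinearMap.proj (R := R) (φ := fun _ => H) i)
    rw [e.isotypicComponent_eq] at h
    exact h ⟨y, hy, rfl⟩
  · intro y z hy hz
    rw [Pi.add_apply]
    exact Submodule.add_mem _ hy hz

/-- THE ISOTYPIC COMPONENT OF A FINITE DIRECT SUM: `(ι → H)[S] = Π_i H[S]`. -/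
theorem isotypicComponent_pi [IsSimpleModule R S] :
    isotypicComponent R (ι → H) S =
      Submodule.pi Set.univ (fun _ : ι => isotypicComponent R H S) := by
  apply le_antisymm
  · intro x hx
    rw [Submodule.mem_pi]
    intro i _
    exact mem_isotypicComponent_apply S hx i
  · rw [← Submodule.iSup_map_single]
    refine iSup_le fun i => ?_
    exact Submodule.map_le_iff_le_comap.mpr
      (LinearMap.le_comap_isotypicComponent S (LinearMap.single R (fun _ : ι => H) i))

/-- The product of submodules `Π_i p i ⊂ Π_i M i` is linearly isomorphic to `Π_i ↥(p i)`. -/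
def piEquiv {M : ι → Type*} [∀ i, AddCommGroup (M i)] [∀ i, Module R (M i)]
    (p : ∀ i, Submodule R (M i)) : Submodule.pi Set.univ p ≃ₗ[R] ∀ i, p i where
  toFun x i := ⟨x.1 i, (Submodule.mem_pi.mp x.2) i (Set.mem_univ i)⟩
  invFun f := ⟨fun i => (f i : M i), Submodule.mem_pi.mpr fun i _ => (f i).2⟩
  left_inv _ := Subtype.ext rfl
  right_inv _ := funext fun _ => Subtype.ext rfl
  map_add' _ _ := funext fun _ => Subtype.ext rfl
  map_smul' _ _ := funext fun _ => Subtype.ext rfl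

/-- `(ι → H)[S] ≃ₗ[R] (ι → H[S])`. -/
noncomputable def isotypicComponentPiEquiv [IsSimpleModule R S] :
    isotypicComponent R (ι → H) S ≃ₗ[R] (ι → isotypicComponent R H S) :=
  (LinearEquiv.ofEq _ _ (isotypicComponent_pi S)).trans
    (piEquiv fun _ : ι => isotypicComponent R H S)

end Module

section Finrank

variable {k R : Type*} [Field k] [Ring R] [Algebra k R] {ι : Type*} [Fintype ι] [DecidableEq ι]
  {H : Type*} [AddCommGroup H] [Module R H] [Module k H] [IsScalarTower k R H]
  (S : Type*) [AddCommGroup S] [Module R S]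

/-- An `R`-submodule of a finite-dimensional `k`-space is finite-dimensional over `k`. -/
theorem finite_submodule [Module.Finite k H] (N : Submodule R H) : Module.Finite k N :=
  Module.Finite.of_injective (N.subtype.restrictScalars k) Subtype.val_injective

/-- THE DIMENSION COUNT: `dim_k (H^{⊕ m})[S] = m · dim_k H[S]`. -/
theorem finrank_isotypicComponent_pi [Module.Finite k H] [IsSimpleModule R S] :
    Module.finrank k (isotypicComponent R (ι → H) S) =
      Fintype.card ι * Module.finrank k (isotypicComponent R H S) := by
  haveI := finite_submodule (k := k) (isotypicComponent R H S)
  haveI : Module.Free k (isotypicComponent R H S) := Module.Free.of_divisionRing k _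
  rw [((isotypicComponentPiEquiv (ι := ι) (H := H) S).restrictScalars k).finrank_eq,
    Module.finrank_pi_fintype, Finset.sum_const, Finset.card_univ, smul_eq_mul]

end Finrank

end Summit.Ventures.HodgeRepro2.T5IsotypicPi
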